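import Summits.Parity.GeneralizedHardyLittlewood.Theses.GoldbachHeathBrownDispersion
import Literature.NumberTheory.Sieve.HeathBrownWeightFourthMoment
import HarnessLib

/-!
# Route `GoldbachHeathBrownDispersion` — assembly item `Assembly` (stmt-Parity-19914; route rev 6)

`Assembly : HeathBrownMorozUniform → ClassTransfer → ModelDispersion → ModelMainTerm →
FourierSideComparison → GoldbachHeathBrownAlmostAll` is pure `ε`-bookkeeping plus Chebyshev's
inequality (the route's deciding theorem `closes` applies it to the five blocks).

Bookkeeping.  `σ₀` = the limit of Heath-Brown's singular product (from `HeathBrownMorozUniform` at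
`Q = 0`; any other instance has the same `σ₀` by uniqueness of limits), `κ = σ₀ 6^{-2/3}/2`;
`c₀` from `ModelMainTerm`; `δ = ε c₀²/16`; `Q₀ = Q₀(κ, δ)` from `ModelDispersion`, `Q = max Q₀ 1`;
`c, σ₀` and the class asymptotics to moduli `d ≤ Q` from `HeathBrownMorozUniform` at `Q`;
`ClassTransfer` (item stmt-Parity-20359, `1 ≤ Q`) turns them into the mass bound `U ≥ κ η² N` and class discrepancies `≤ ε₁ U`;
`A = 4c + 1` and `B` from `FourierSideComparison`; `N₀(c, B)` from `ModelMainTerm`; `C, N₀` from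
`ModelDispersion` at `(c, B)`; `ε₁ = min 1 (δ / max C 1)` so that `C N (ε₁U)² ≤ δ U² N`; finally
`N` so large that `C_F ≤ (ε c₀² κ²/8) log N`, which with `η⁴ ≥ (log N)^{-4c}` gives
`C_F N³ (log N)^{-A} ≤ (ε c₀²/8) N U²`.

Counting.  An even `n ∈ (N, 2N]` with no representation `p + (x³+2y³)` has
`∑_k u(k) θ𝟙_ℙ(n−k) = 0` (`u = hbWeight c N` is supported on prime values of `x³ + 2y³` with
`x, y ≥ 1`), so with `E(n) = ∑_k u(k)(θ𝟙_ℙ − g)(n−k)` and `D(n) = ∑_k (u − ũ)(k) g(n−k)` one has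
`E(n) + D(n) = −∑_k ũ(k) g(n−k) ≤ −c₀ U`, hence `c₀ U ≤ |E(n)| + |D(n)|` and
`(c₀U/2)² ≤ E(n)² + D(n)²`.  Summing over the exceptional `n` and using the two variance bounds,
`#{exceptional n} · (c₀U/2)² ≤ C_F N³(log N)^{-A} + 2δU²N ≤ εN · (c₀U/2)²`.

References: H. L. Montgomery, R. C. Vaughan, Acta Arith. 27 (1975) §7 [MontgomeryVaughan1975];
R. C. Vaughan, *The Hardy–Littlewood Method* (1997) §3.2 [Vaughan1997].
-/

open Filter
open Literature.NumberTheory.Sieve Literature.NumberTheory.Sieve.CubicPrimes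
open Literature.NumberTheory.Sieve.CubicMinorant

namespace Summit.Parity.GeneralizedHardyLittlewood.Theorems

namespace GoldbachHeathBrownDispersionAssembly

/-- Chebyshev-type count: if every `n ∈ S` with `p n` has `a ≤ |E n| + |D n|` (`a > 0`) and the two
second moments over `S` are `≤ F`, `≤ V` with `F + V ≤ bound · (a/2)²`, then
`#{n ∈ S : p n} ≤ bound` (the decidability instance is an implicit argument, so that it unifies with
the classical instance of the route file). [folklore] -/
theorem card_filter_le_of_second_moments {S : Finset ℕ} {p : ℕ → Prop} {hdec : DecidablePred p}
    {E D : ℕ → ℝ} {a F V bound : ℝ}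
    (hF : ∑ n ∈ S, E n ^ 2 ≤ F) (hV : ∑ n ∈ S, D n ^ 2 ≤ V) (ha : 0 < a)
    (hkey : ∀ n ∈ S, p n → a ≤ |E n| + |D n|) (hb : F + V ≤ bound * (a / 2) ^ 2) :
    ((S.filter p).card : ℝ) ≤ bound := by
  have hTS : S.filter p ⊆ S := Finset.filter_subset _ _
  have h1 : ∀ n ∈ S.filter p, (a / 2) ^ 2 ≤ E n ^ 2 + D n ^ 2 := by
    intro n hn
    obtain ⟨hnS, hpn⟩ := Finset.mem_filter.mp hn
    have hk := hkey n hnS hpn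
    by_cases hE : a / 2 ≤ |E n|
    · have h2 : (a / 2) ^ 2 ≤ |E n| ^ 2 := pow_le_pow_left₀ (by linarith) hE 2
      rw [sq_abs] at h2
      nlinarith [sq_nonneg (D n)]
    · have hD : a / 2 ≤ |D n| := by linarith [not_le.mp hE]
      have h2 : (a / 2) ^ 2 ≤ |D n| ^ 2 := pow_le_pow_left₀ (by linarith) hD 2
      rw [sq_abs] at h2
      nlinarith [sq_nonneg (E n)]
  have h2 : ((S.filter p).card : ℝ) * (a / 2) ^ 2 ≤ ∑ n ∈ S.filter p, (E n ^ 2 + D n ^ 2) := by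
    have h := Finset.card_nsmul_le_sum (S.filter p) (fun n => E n ^ 2 + D n ^ 2) ((a / 2) ^ 2) h1
    simpa [nsmul_eq_mul] using h
  have h3 : ∑ n ∈ S.filter p, (E n ^ 2 + D n ^ 2) ≤ F + V := by
    rw [Finset.sum_add_distrib]
    exact add_le_add
      ((Finset.sum_le_sum_of_subset_of_nonneg hTS (fun _ _ _ => sq_nonneg _)).trans hF)
      ((Finset.sum_le_sum_of_subset_of_nonneg hTS (fun _ _ _ => sq_nonneg _)).trans hV)
  have hpos : 0 < (a / 2) ^ 2 := by positivity
  exact le_of_mul_le_mul_right (h2.trans (h3.trans hb)) hpos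

/-- The per-`n` algebra of the dispersion method: if `∑_k u(k) θ(n−k) = 0` and
`m ≤ ∑_k ũ(k) g(n−k)`, then `m ≤ |∑_k u(k)(θ − g)(n−k)| + |∑_k (u − ũ)(k) g(n−k)|`, because the two
sums add up to `∑_k u θ − ∑_k ũ g = −∑_k ũ g`. [folklore] -/
theorem le_abs_add_abs_of_sum_eq_zero {N n : ℕ} {m : ℝ} (u ũ θ g : ℕ → ℝ)
    (hzero : ∀ k ∈ Finset.Icc 1 N, u k * θ (n - k) = 0)
    (hmain : m ≤ ∑ k ∈ Finset.Icc 1 N, ũ k * g (n - k)) :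
    m ≤ |∑ k ∈ Finset.Icc 1 N, u k * (θ (n - k) - g (n - k))| +
      |∑ k ∈ Finset.Icc 1 N, (u k - ũ k) * g (n - k)| := by
  have hsum0 : ∑ k ∈ Finset.Icc 1 N, u k * θ (n - k) = 0 := Finset.sum_eq_zero hzero
  have hED : ∑ k ∈ Finset.Icc 1 N, u k * (θ (n - k) - g (n - k)) +
      ∑ k ∈ Finset.Icc 1 N, (u k - ũ k) * g (n - k) = -∑ k ∈ Finset.Icc 1 N, ũ k * g (n - k) := by
    have h1 : ∑ k ∈ Finset.Icc 1 N, u k * (θ (n - k) - g (n - k)) +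
        ∑ k ∈ Finset.Icc 1 N, (u k - ũ k) * g (n - k) =
        ∑ k ∈ Finset.Icc 1 N, u k * θ (n - k) - ∑ k ∈ Finset.Icc 1 N, ũ k * g (n - k) := by
      rw [← Finset.sum_add_distrib, ← Finset.sum_sub_distrib]
      exact Finset.sum_congr rfl fun k _ => by ring
    rw [h1, hsum0, zero_sub]
  calc m ≤ ∑ k ∈ Finset.Icc 1 N, ũ k * g (n - k) := hmain
    _ = -(∑ k ∈ Finset.Icc 1 N, u k * (θ (n - k) - g (n - k)) +
          ∑ k ∈ Finset.Icc 1 N, (u k - ũ k) * g (n - k)) := by rw [hED, neg_neg]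
    _ ≤ |∑ k ∈ Finset.Icc 1 N, u k * (θ (n - k) - g (n - k)) +
          ∑ k ∈ Finset.Icc 1 N, (u k - ũ k) * g (n - k)| := neg_le_abs _
    _ ≤ _ := abs_add_le _ _

/-- Support of the Heath-Brown weight against the prime indicator: if `n` has no representation
`p + (x³ + 2y³)` with `p` and `x³ + 2y³` prime, `x, y ≥ 1`, then for every `k ≤ n` the term
`hbWeight c N k · θ𝟙_ℙ(n − k)` vanishes (a non-zero weight at `k` exhibits `k = x³ + 2y³` prime with
`x, y ≥ 1`, and a prime `n − k` would complete a representation). [cite: HeathBrownActa2001, Theorem 1 (the weight counts prime values of x³+2y³ in the box)] -/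
theorem hbWeight_mul_primeLog_eq_zero {c : ℝ} {N n k : ℕ} (hkn : k ≤ n)
    (hn : ¬ ∃ p x y : ℕ, 0 < x ∧ 0 < y ∧ p.Prime ∧ (x ^ 3 + 2 * y ^ 3).Prime ∧
      p + (x ^ 3 + 2 * y ^ 3) = n) :
    hbWeight c N k * (if (n - k).Prime then Real.log ((n - k : ℕ) : ℝ) else 0) = 0 := by
  by_contra h
  obtain ⟨hw, hθ⟩ := mul_ne_zero_iff.mp h
  have hp : (n - k).Prime := by
    by_contra hp
    exact hθ (if_neg hp)
  have hrep : hbRep c N k ≠ 0 := by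
    intro hr
    apply hw
    simp [hbWeight, hr]
  obtain ⟨⟨x, y⟩, hxy⟩ := Finset.card_ne_zero.1 hrep
  rw [Finset.mem_filter] at hxy
  obtain ⟨hmem, hval⟩ := hxy
  simp only at hval
  rw [mem_primePairs_iff] at hmem
  obtain ⟨hXx, -, hXy, -, -, hprime⟩ := hmem
  have hX0 : 0 ≤ hbX N := hbX_nonneg N
  have hx0 : (0 : ℝ) < x := hX0.trans_lt hXx
  have hy0 : (0 : ℝ) < y := hX0.trans_lt hXy
  exact hn ⟨n - k, x, y, by exact_mod_cast hx0, by exact_mod_cast hy0, hp, hprime, by rw [hval]; omega⟩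

/-- The Fourier-side term: with `L = log N > 0`, `C_F ≤ K·L`, `K ≥ 0` and `L^{-4c} ≤ η4`,
`C_F · N3 · L^{-(4c+1)} ≤ K · N3 · η4` (`N3 ≥ 0`). [folklore] -/
theorem fourierTerm_le {c CF K L η4 N3 : ℝ} (hL : 0 < L) (hCF : CF ≤ K * L) (hK : 0 ≤ K)
    (hη : L ^ (-(4 * c)) ≤ η4) (hN3 : 0 ≤ N3) :
    CF * N3 * L ^ (-(4 * c + 1)) ≤ K * N3 * η4 := by
  have h1 : L ^ (-(4 * c + 1)) = L ^ (-(4 * c)) / L := by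
    rw [show -(4 * c + 1) = -(4 * c) + (-1) by ring, Real.rpow_add hL, Real.rpow_neg_one,
      div_eq_mul_inv]
  have h2 : CF / L ≤ K := by rwa [div_le_iff₀ hL]
  have h3 : 0 ≤ L ^ (-(4 * c)) := Real.rpow_nonneg hL.le _
  calc CF * N3 * L ^ (-(4 * c + 1)) = CF / L * (N3 * L ^ (-(4 * c))) := by rw [h1]; ring
    _ ≤ K * (N3 * L ^ (-(4 * c))) := mul_le_mul_of_nonneg_right h2 (mul_nonneg hN3 h3)
    _ ≤ K * (N3 * η4) := mul_le_mul_of_nonneg_left (mul_le_mul_of_nonneg_left hη hN3) hK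
    _ = K * N3 * η4 := by ring

/-- The model-error term: with `0 ≤ ε₁ ≤ 1`, `ε₁ ≤ δ / max C 1`, `δ, N ≥ 0`:
`C · N · (ε₁ U)² ≤ δ · U² · N`. [folklore] -/
theorem modelError_le {C δ ε₁ U N : ℝ} (hε₀ : 0 ≤ ε₁) (hε₁ : ε₁ ≤ 1)
    (hεC : ε₁ ≤ δ / max C 1) (hN : 0 ≤ N) :
    C * N * (ε₁ * U) ^ 2 ≤ δ * U ^ 2 * N := by
  have hM : 0 < max C 1 := lt_max_of_lt_right one_pos
  have h1 : ε₁ * max C 1 ≤ δ := by rwa [le_div_iff₀ hM] at hεC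
  have h2 : ε₁ ^ 2 ≤ ε₁ := by nlinarith
  have hNU : 0 ≤ N * U ^ 2 := by positivity
  calc C * N * (ε₁ * U) ^ 2 = C * (ε₁ ^ 2 * (N * U ^ 2)) := by ring
    _ ≤ max C 1 * (ε₁ ^ 2 * (N * U ^ 2)) :=
        mul_le_mul_of_nonneg_right (le_max_left _ _) (by positivity)
    _ ≤ max C 1 * (ε₁ * (N * U ^ 2)) :=
        mul_le_mul_of_nonneg_left (mul_le_mul_of_nonneg_right h2 hNU) hM.le
    _ = ε₁ * max C 1 * (N * U ^ 2) := by ring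
    _ ≤ δ * (N * U ^ 2) := mul_le_mul_of_nonneg_right h1 hNU
    _ = δ * U ^ 2 * N := by ring

/-- `η⁴ = (log X)^{-4c} ≥ (log N)^{-4c}` for `N > 6`, `c ≥ 0` (`0 < log X ≤ log N`). [cite: HeathBrownActa2001, Theorem 1 (the box X < x, y ≤ X(1+η) with η = (log X)^{-c})] -/
theorem log_rpow_neg_le_hbEta_pow_four {c : ℝ} (hc : 0 ≤ c) {N : ℕ} (hN : 6 < N) :
    Real.log N ^ (-(4 * c)) ≤ hbEta c N ^ 4 := by
  obtain ⟨-, hLX, hLXle⟩ := hbX_facts hN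
  have h1 : hbEta c N ^ 4 = Real.log (hbX N) ^ (-(4 * c)) := by
    unfold hbEta
    rw [← Real.rpow_natCast, ← Real.rpow_mul hLX.le]
    congr 1
    push_cast
    ring
  rw [h1]
  exact Real.rpow_le_rpow_of_nonpos hLX hLXle (by linarith)

end GoldbachHeathBrownDispersionAssembly

open GoldbachHeathBrownDispersionAssembly

/-- **`Assembly` holds** (route `GoldbachHeathBrownDispersion`, item stmt-Parity-19914): the five blocks
`HeathBrownMorozUniform`, `ClassTransfer`, `ModelDispersion`, `ModelMainTerm`,
`FourierSideComparison` imply `GoldbachHeathBrownAlmostAll` — for every `ε > 0` and `N ≥ N₀(ε)`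
the number of even `n ∈ (N, 2N]` that are not `p + (x³ + 2y³)` with both summands prime,
`x, y ≥ 1`, is at most `εN`.  Proof: the `ε`-bookkeeping of the module docstring (uniqueness of
the limit `σ₀`; `δ = εc₀²/16`, `Q = max Q₀ 1`, `A = 4c + 1`, `ε₁ = min 1 (δ/max C 1)`,
`log N ≥ 8C_F/(εc₀²κ²)`), the per-`n` inequality `c₀U ≤ |E(n)| + |D(n)|` for exceptional `n`, and
Chebyshev's inequality against the two variance bounds. -/
theorem goldbachHeathBrownDispersion_assembly_proof :
    Summit.Parity.GeneralizedHardyLittlewood.Theses.GoldbachHeathBrownDispersion.Assembly := by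
  unfold Summit.Parity.GeneralizedHardyLittlewood.Theses.GoldbachHeathBrownDispersion.Assembly
  intro hK1 hCT hMD hMM hF
  unfold Summit.Parity.GeneralizedHardyLittlewood.Theses.GoldbachHeathBrownDispersion.GoldbachHeathBrownAlmostAll
  unfold Summit.Parity.GeneralizedHardyLittlewood.Theses.GoldbachHeathBrownDispersion.HeathBrownMorozUniform at hK1
  unfold Summit.Parity.GeneralizedHardyLittlewood.Theses.GoldbachHeathBrownDispersion.ClassTransfer at hCT
  unfold Summit.Parity.GeneralizedHardyLittlewood.Theses.GoldbachHeathBrownDispersion.ModelDispersion at hMD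
  unfold Summit.Parity.GeneralizedHardyLittlewood.Theses.GoldbachHeathBrownDispersion.ModelMainTerm at hMM
  unfold Summit.Parity.GeneralizedHardyLittlewood.Theses.GoldbachHeathBrownDispersion.FourierSideComparison at hF
  intro ε hε
  -- (1) σ₀ (pinned by uniqueness of limits) and κ = σ₀ 6^{-2/3}/2
  obtain ⟨-, -, σ₀, hσ₀, hlim, -⟩ := hK1 0
  have hκ : 0 < σ₀ * (6 : ℝ) ^ (-(2 / 3 : ℝ)) / 2 := by positivity
  -- (2) the absolute main-term constant c₀
  obtain ⟨c₀, hc₀, hMM₁⟩ := hMM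
  -- (3) δ = ε c₀²/16 and the c-free class threshold Q₀; Q = max Q₀ 1
  have hδ : 0 < ε * c₀ ^ 2 / 16 := by positivity
  obtain ⟨Q₀, hMD₁⟩ := hMD (σ₀ * (6 : ℝ) ^ (-(2 / 3 : ℝ)) / 2) (ε * c₀ ^ 2 / 16) hκ hδ
  -- (4) Heath-Brown–Moroz to moduli ≤ Q: the box exponent c
  obtain ⟨c, hc, σ₁, -, hlim₁, hcls⟩ := hK1 (max Q₀ 1)
  have hσ : σ₁ = σ₀ := tendsto_nhds_unique hlim₁ hlim
  -- (5) ClassTransfer: mass lower bound and class discrepancies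
  obtain ⟨⟨N₁, hmass⟩, hdisc⟩ :=
    hCT (max Q₀ 1) (le_max_right _ _) c σ₀ hc hσ₀ hlim (by rw [← hσ]; exact hcls)
  -- (6) Fourier side with A = 4c + 1: the rough level B
  obtain ⟨B, hB, CF, N₃, hF₁⟩ := hF c hc (4 * c + 1) (by linarith)
  -- (7) main term and dispersion at (c, B)
  obtain ⟨N₄, hMM₂⟩ := hMM₁ c B hc hB
  obtain ⟨C, N₅, hMD₂⟩ := hMD₁ c B hc hB
  -- (8) the class tolerance ε₁
  have hmax : 0 < max C 1 := lt_max_of_lt_right one_pos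
  have hε₁ : 0 < min 1 (ε * c₀ ^ 2 / 16 / max C 1) := lt_min one_pos (div_pos hδ hmax)
  obtain ⟨N₂, hdisc₁⟩ := hdisc (min 1 (ε * c₀ ^ 2 / 16 / max C 1)) hε₁
  -- (9) log N large
  have hK : 0 < ε * c₀ ^ 2 * (σ₀ * (6 : ℝ) ^ (-(2 / 3 : ℝ)) / 2) ^ 2 / 8 := by positivity
  obtain ⟨N₆, hN₆⟩ : ∃ N₆ : ℕ, ∀ N : ℕ, N₆ ≤ N →
      CF ≤ ε * c₀ ^ 2 * (σ₀ * (6 : ℝ) ^ (-(2 / 3 : ℝ)) / 2) ^ 2 / 8 * Real.log N := by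
    have ht : Tendsto (fun N : ℕ => ε * c₀ ^ 2 * (σ₀ * (6 : ℝ) ^ (-(2 / 3 : ℝ)) / 2) ^ 2 / 8 *
        Real.log N) atTop atTop :=
      (Real.tendsto_log_atTop.comp tendsto_natCast_atTop_atTop).const_mul_atTop hK
    exact Filter.eventually_atTop.mp (ht.eventually_ge_atTop CF)
  -- (10) the threshold
  refine ⟨N₁ + N₂ + N₃ + N₄ + N₅ + N₆ + 7, fun N hN => ?_⟩
  have hN1 : N₁ ≤ N := by omega
  have hN2 : N₂ ≤ N := by omega
  have hN3 : N₃ ≤ N := by omega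
  have hN4 : N₄ ≤ N := by omega
  have hN5 : N₅ ≤ N := by omega
  have hN6 : N₆ ≤ N := by omega
  have hN7 : 6 < N := by omega
  have hNpos : (0 : ℝ) < N := by exact_mod_cast (show 0 < N by omega)
  obtain ⟨-, hLX, hLXle⟩ := hbX_facts hN7
  have hlogN : 0 < Real.log N := hLX.trans_le hLXle
  have hηpos : 0 < hbEta c N := Real.rpow_pos_of_pos hLX _
  have hη4 := log_rpow_neg_le_hbEta_pow_four hc.le hN7
  -- the blocks at this N
  have hmassN := hmass N hN1
  have hFN := hF₁ N hN3
  have hV := hMD₂ N hN5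
    (min 1 (ε * c₀ ^ 2 / 16 / max C 1) * ∑ k ∈ Finset.Icc 1 N, hbWeight c N k) hmassN
    (fun d hd hdQ hsq r hr => hdisc₁ N hN2 d hd (hdQ.trans (le_max_left _ _)) hsq r hr)
  have hCF := hN₆ N hN6
  set U : ℝ := ∑ k ∈ Finset.Icc 1 N, hbWeight c N k with hU
  have hκηN : 0 < σ₀ * (6 : ℝ) ^ (-(2 / 3 : ℝ)) / 2 * hbEta c N ^ 2 * N := by positivity
  have hUpos : 0 < U := hκηN.trans_le hmassN
  -- the two error terms
  have hFle : CF * (N : ℝ) ^ 3 * Real.log N ^ (-(4 * c + 1)) ≤ ε * c₀ ^ 2 / 8 * N * U ^ 2 := by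
    have h1 := fourierTerm_le hlogN hCF hK.le hη4 (by positivity : (0 : ℝ) ≤ (N : ℝ) ^ 3)
    have h2 : (σ₀ * (6 : ℝ) ^ (-(2 / 3 : ℝ)) / 2 * hbEta c N ^ 2 * N) ^ 2 ≤ U ^ 2 :=
      pow_le_pow_left₀ hκηN.le hmassN 2
    have h3 : ε * c₀ ^ 2 * (σ₀ * (6 : ℝ) ^ (-(2 / 3 : ℝ)) / 2) ^ 2 / 8 * (N : ℝ) ^ 3 * hbEta c N ^ 4 =
        ε * c₀ ^ 2 / 8 * N * (σ₀ * (6 : ℝ) ^ (-(2 / 3 : ℝ)) / 2 * hbEta c N ^ 2 * N) ^ 2 := by ring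
    have h4 : 0 ≤ ε * c₀ ^ 2 / 8 * (N : ℝ) := by positivity
    calc CF * (N : ℝ) ^ 3 * Real.log N ^ (-(4 * c + 1))
        ≤ ε * c₀ ^ 2 / 8 * N * (σ₀ * (6 : ℝ) ^ (-(2 / 3 : ℝ)) / 2 * hbEta c N ^ 2 * N) ^ 2 := by
          rw [← h3]; exact h1
      _ ≤ ε * c₀ ^ 2 / 8 * N * U ^ 2 := mul_le_mul_of_nonneg_left h2 h4
  have hCerr : C * N * (min 1 (ε * c₀ ^ 2 / 16 / max C 1) * U) ^ 2 ≤ ε * c₀ ^ 2 / 16 * U ^ 2 * N :=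
    modelError_le hε₁.le (min_le_left _ _) (min_le_right _ _) hNpos.le
  -- Chebyshev
  refine card_filter_le_of_second_moments hFN hV (a := c₀ * U) (by positivity) ?_ ?_
  · intro n hn hbad
    obtain ⟨heven, hnorep⟩ := hbad
    obtain ⟨hNn, hn2N⟩ := Finset.mem_Ioc.mp hn
    have hmain := hMM₂ N hN4 n hNn hn2N heven
    exact le_abs_add_abs_of_sum_eq_zero (hbWeight c N) _
      (fun m : ℕ => if m.Prime then Real.log (m : ℝ) else 0) (roughModel B (2 * N))
      (fun k hk => hbWeight_mul_primeLog_eq_zero (by have := (Finset.mem_Icc.mp hk).2; omega) hnorep)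
      hmain
  · nlinarith [hFle, hCerr, hUpos, hc₀, hε]

end Summit.Parity.GeneralizedHardyLittlewood.Theorems
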